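import Summits.Ventures.Crystal3D.Theorems.StickyWulffConstantCoaxialWallLawSeamDozenVacancyCensus
import Summits.Ventures.Crystal3D.Theorems.StickyWulffConstantGenericWallFloorEndBallMenuTable
import HarnessLib

/-!
# TWIN VACANCY CENSUS for EVERY composition normal: the sign-changed twin dozens `twinSiteC c` and the bridge to the lane's `(G, m)` twin readings
# (crux `CoaxialWallLaw`, stmt-Ventures-19481; lane F 'Certificates' v8.3R, registered stub `stub_threePayer`, piece `SatCensus11Full` of the (L2) split)

HONEST FRAMING. Venture `Summits/Ventures/Crystal3D` (cell `crystal3d-full`); sequel of '…SeamDozenVacancyCensus' (`twinSite` = the twin dozen for the model normal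
`(1,1,1)/√3`).  Seat 19481-p2 g14 found (kit j335656, memo F-TAIL-g14 §5) that every FULL-reader row surviving the individual cap tests does so through ONE free-ball
position: a MIRROR position of `b`'s frame that makes `b`'s contact shell a TWIN DOZEN MINUS ONE MEMBER for a normal `(±1,±1,±1)/√3` of the class frame — so the
twin vacancy census is needed for all eight signed normals, in the lane's currency (`IsMenuNormal G m`: own slots `G w`, `⟪G w, m⟫ ≤ 0`, and mirror balls
`G w − 2⟪G w, m⟫ m`, `⟪G w, m⟫ < 0`).  THIS FILE: the sign-changed families `twinSiteC c` (`c : Fin 8`, sign vectors `cubeInt c`), their dozen-frame structure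
(same tables), the named cap rows `VacancyCapTwinC c`, the census `two_unsaturated_of_twinCVacancyShell`, and the BRIDGE: with `nC c` the unit normal of cubic
coordinates `cubeInt c/√3` (every menu normal of `G` is `G (nC c)`, `exists_cubeInt_of_menu_normal`), the family `twinSiteC c` consists exactly of the own slots
(`slotInt j ⬝ cubeInt c ≤ 0`) and the mirror images `slot j − 2⟪slot j, nC c⟫ nC c` (`slotInt j ⬝ cubeInt c = −2`).
* `twinIntC`, `twinSiteC`, `cubicCoords_twinSiteC`, `inner_twinSiteC`, `isDozenFrame_twinC`, **`VacancyCapTwinC`**, **`two_unsaturated_of_twinCVacancyShell`**;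
* `nC`, `norm_nC`, `inner_slotSite_nC`, `eq_map_nC_of_menu` (a menu normal `m` of `G` is `G (nC c)`), `twinSiteC_own`, `twinSiteC_mirror`, `twinSiteC_cases`.
WHAT THIS IS NOT: no cap row is proved (kit j335336 P2a: margins 0.950–0.982); F-C1 not moved.
-/

noncomputable section

namespace Summit.Ventures.Crystal3D.Theorems

namespace TailResidue

open Summit.Ventures.Crystal3D Finset NearIdentity
open scoped InnerProductSpace Matrix

variable {X : Finset (EuclideanSpace ℝ (Fin 3))}

/-! ### The sign-changed twin dozens -/

/-- Integer table of the twin dozen for the sign vector `cubeInt c`: componentwise product with `twinInt`. -/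
def twinIntC (c : Fin 8) (k : Fin 12) (i : Fin 3) : ℤ := cubeInt c i * twinInt k i

/-- **The twin dozen with composition normal `cubeInt c/√3`** (cubic frame). -/
def twinSiteC (c : Fin 8) (k : Fin 12) : EuclideanSpace ℝ (Fin 3) :=
  ∑ i : Fin 3, ((twinIntC c k i : ℝ) / (3 * Real.sqrt 2)) • cubicFrame i

/-- The entries of `cubeInt` are signs. -/
theorem cubeInt_sq : ∀ c : Fin 8, ∀ i : Fin 3, cubeInt c i * cubeInt c i = 1 := by decide

/-- The product of the three signs is non-zero. -/
theorem cubeInt_prod_ne : ∀ c : Fin 8, cubeInt c 0 * cubeInt c 1 * cubeInt c 2 ≠ 0 := by decide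

/-- Sign changes preserve dot products. -/
theorem dot_twinIntC (c : Fin 8) (k l : Fin 12) : twinIntC c k ⬝ᵥ twinIntC c l = twinInt k ⬝ᵥ twinInt l := by
  simp only [dotProduct, Fin.sum_univ_three, twinIntC]
  have h0 := cubeInt_sq c 0; have h1 := cubeInt_sq c 1; have h2 := cubeInt_sq c 2
  linear_combination (twinInt k 0 * twinInt l 0) * h0 + (twinInt k 1 * twinInt l 1) * h1 + (twinInt k 2 * twinInt l 2) * h2

/-- Sign changes scale triple products by the sign product. -/
theorem det_twinIntC (c : Fin 8) (i j l : Fin 12) :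
    twinIntC c i ⬝ᵥ crossInt (twinIntC c j) (twinIntC c l) = (cubeInt c 0 * cubeInt c 1 * cubeInt c 2) * (twinInt i ⬝ᵥ crossInt (twinInt j) (twinInt l)) := by
  simp only [dotProduct, Fin.sum_univ_three, twinIntC, crossInt, Matrix.cons_val_zero, Matrix.cons_val_one, Matrix.cons_val]
  ring

/-- Cubic coordinates of the sign-changed twin dozen. -/
theorem cubicCoords_twinSiteC (c : Fin 8) (k : Fin 12) : cubicCoords (twinSiteC c k) = fun i => (twinIntC c k i : ℝ) / (3 * Real.sqrt 2) := by
  rw [twinSiteC, Fin.sum_univ_three, cubicCoords_add, cubicCoords_add, cubicCoords_smul, cubicCoords_smul, cubicCoords_smul, cubicCoords_cubicFrame,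
    cubicCoords_cubicFrame, cubicCoords_cubicFrame]
  ext i
  fin_cases i <;> simp

/-- `⟪twinSiteC c k, twinSiteC c l⟫ = (twinInt k ⬝ twinInt l)/18`. -/
theorem inner_twinSiteC (c : Fin 8) (k l : Fin 12) : ⟪twinSiteC c k, twinSiteC c l⟫_ℝ = ((twinInt k ⬝ᵥ twinInt l : ℤ) : ℝ) / 18 := by
  rw [inner_eq_cubicCoords, cubicCoords_twinSiteC, cubicCoords_twinSiteC, ← dot_twinIntC c]
  simp only [dotProduct, Fin.sum_univ_three]
  have hs : Real.sqrt 2 ^ 2 = 2 := Real.sq_sqrt (by norm_num)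
  push_cast
  field_simp
  rw [hs]; ring

/-- Unit vectors. -/
theorem norm_twinSiteC (c : Fin 8) (k : Fin 12) : ‖twinSiteC c k‖ = 1 := by
  have h : ‖twinSiteC c k‖ ^ 2 = 1 := by rw [← real_inner_self_eq_norm_sq, inner_twinSiteC, twin_tables.1 k]; norm_num
  nlinarith [norm_nonneg (twinSiteC c k)]

/-- `dist = 1 ↔ dot = 9`. -/
theorem dist_twinSiteC_eq_one_iff (c : Fin 8) (k l : Fin 12) : dist (twinSiteC c k) (twinSiteC c l) = 1 ↔ twinInt k ⬝ᵥ twinInt l = 9 := by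
  have h : dist (twinSiteC c k) (twinSiteC c l) ^ 2 = 2 - ((twinInt k ⬝ᵥ twinInt l : ℤ) : ℝ) / 9 := by
    rw [dist_eq_norm, ← real_inner_self_eq_norm_sq, inner_sub_left, inner_sub_right, inner_sub_right, inner_twinSiteC, inner_twinSiteC, inner_twinSiteC,
      inner_twinSiteC, twin_tables.1 k, twin_tables.1 l, show twinInt l ⬝ᵥ twinInt k = twinInt k ⬝ᵥ twinInt l from dotProduct_comm _ _]
    push_cast; ring
  have h0 : 0 ≤ dist (twinSiteC c k) (twinSiteC c l) := dist_nonneg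
  constructor
  · intro h1; rw [h1, one_pow] at h
    have : ((twinInt k ⬝ᵥ twinInt l : ℤ) : ℝ) = 9 := by linarith
    exact_mod_cast this
  · intro h1; rw [h1] at h; push_cast at h; nlinarith

/-- Linear independence from the integer triple product. -/
theorem linearIndependent_twinSiteC (c : Fin 8) {i j k : Fin 12} (h : twinInt i ⬝ᵥ crossInt (twinInt j) (twinInt k) ≠ 0) :
    LinearIndependent ℝ ![twinSiteC c i, twinSiteC c j, twinSiteC c k] := by
  classical
  have h' : twinIntC c i ⬝ᵥ crossInt (twinIntC c j) (twinIntC c k) ≠ 0 := by rw [det_twinIntC]; exact mul_ne_zero (cubeInt_prod_ne c) h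
  rw [Fintype.linearIndependent_iff]
  intro g hg
  set M : Matrix (Fin 3) (Fin 3) ℝ := Matrix.of fun r s => (twinIntC c (![i, j, k] r) s : ℝ) with hM
  have hdet : M.det ≠ 0 := by
    have e : M.det = ((twinIntC c i ⬝ᵥ crossInt (twinIntC c j) (twinIntC c k) : ℤ) : ℝ) := by
      rw [Matrix.det_fin_three]; simp [hM, crossInt, dotProduct, Fin.sum_univ_three]; ring
    rw [e]; exact_mod_cast h'
  have hvec : g ᵥ* M = 0 := by
    have hc := congrArg cubicCoords hg
    simp only [Fin.sum_univ_three, Matrix.cons_val_zero, Matrix.cons_val_one, Matrix.cons_val, cubicCoords_add, cubicCoords_smul, cubicCoords_twinSiteC] at hc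
    have hc0 : cubicCoords (0 : EuclideanSpace ℝ (Fin 3)) = 0 := by
      have := cubicCoords_smul 0 (0 : EuclideanSpace ℝ (Fin 3)); rwa [zero_smul, zero_smul] at this
    rw [hc0] at hc
    ext s
    have hcc := congrFun hc s
    simp only [Pi.add_apply, Pi.smul_apply, smul_eq_mul, Pi.zero_apply] at hcc
    simp only [Matrix.vecMul, dotProduct, Fin.sum_univ_three, hM, Matrix.of_apply, Matrix.cons_val_zero, Matrix.cons_val_one, Matrix.cons_val, Pi.zero_apply]
    have hs : (3 : ℝ) * Real.sqrt 2 ≠ 0 := by positivity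
    field_simp at hcc
    linarith
  have := Matrix.eq_zero_of_vecMul_eq_zero hdet hvec
  intro r; exact congrFun this r

/-- **The sign-changed twin dozens are dozen frames** (same neighbour table `twinNbr`). -/
theorem isDozenFrame_twinC (c : Fin 8) : IsDozenFrame (twinSiteC c) twinNbr where
  norm_one := norm_twinSiteC c
  nbr_dist k i := (dist_twinSiteC_eq_one_iff c k (twinNbr k i)).2 (twin_tables.2.1 k i)
  nbr_complete k l h := twin_tables.2.2.2.1 k l ((dist_twinSiteC_eq_one_iff c k l).1 h)
  nbr_inj := twin_tables.2.2.1
  nbr_ne := twin_tables.2.2.2.2.1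
  indep k o i j l hoi hoj hol hij hil hjl := linearIndependent_twinSiteC c (twin_tables.2.2.2.2.2.1 k o i j l hoi hoj hol hij hil hjl)
  inj k l h := by
    apply twin_tables.2.2.2.2.2.2 k l
    have hc := congrArg cubicCoords h
    rw [cubicCoords_twinSiteC, cubicCoords_twinSiteC] at hc
    funext s
    have hcc := congrFun hc s
    have hs : (3 : ℝ) * Real.sqrt 2 ≠ 0 := by positivity
    have h1 : ((twinIntC c k s : ℤ) : ℝ) = twinIntC c l s := by simpa [div_left_inj' hs] using hcc
    have h2 : twinIntC c k s = twinIntC c l s := by exact_mod_cast h1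
    have h3 := congrArg (fun t => cubeInt c s * t) h2
    simp only [twinIntC, ← mul_assoc, cubeInt_sq, one_mul] at h3
    exact h3

/-- **TWIN VACANCY CAP for the normal `cubeInt c/√3` (named input, certificate-shaped).** -/
def VacancyCapTwinC (c : Fin 8) : Prop := DozenVacancyCap (twinSiteC c) twinNbr

open scoped Classical in
/-- **TWIN VACANCY CENSUS, every composition normal.**  Under GAP(5/2) and `VacancyCapTwinC c`: if eleven of the twelve balls `b + A(twinSiteC c l)` of a twin dozen of
`b ∈ X` are present and the twelfth is absent, two distinct neighbours of `b` have at most eleven contacts. -/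
theorem two_unsaturated_of_twinCVacancyShell {c : Fin 8} (hg : KissingGap (5 / 2)) (hcap : VacancyCapTwinC c) (hX : ∀ p ∈ X, ∀ q ∈ X, p ≠ q → 1 ≤ dist p q)
    (A : EuclideanSpace ℝ (Fin 3) ≃ₗᵢ[ℝ] EuclideanSpace ℝ (Fin 3)) {b : EuclideanSpace ℝ (Fin 3)} (hb : b ∈ X) {k : Fin 12}
    (hocc : ∀ l : Fin 12, l ≠ k → b + A (twinSiteC c l) ∈ X) (hvac : b + A (twinSiteC c k) ∉ X) :
    ∃ y ∈ X, ∃ y' ∈ X, y ≠ y' ∧ dist b y = 1 ∧ dist b y' = 1 ∧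
      (X.filter fun q => dist y q = 1).card ≤ 11 ∧ (X.filter fun q => dist y' q = 1).card ≤ 11 :=
  two_unsaturated_of_dozenVacancy hg (isDozenFrame_twinC c) hcap hX A hb hocc hvac

/-! ### The bridge to menu normals -/

/-- The unit normal with cubic coordinates `cubeInt c/√3`. -/
def nC (c : Fin 8) : EuclideanSpace ℝ (Fin 3) := ∑ i : Fin 3, ((cubeInt c i : ℝ) / Real.sqrt 3) • cubicFrame i

/-- Cubic coordinates of `nC c`. -/
theorem cubicCoords_nC (c : Fin 8) : cubicCoords (nC c) = fun i => (cubeInt c i : ℝ) / Real.sqrt 3 := by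
  rw [nC, Fin.sum_univ_three, cubicCoords_add, cubicCoords_add, cubicCoords_smul, cubicCoords_smul, cubicCoords_smul, cubicCoords_cubicFrame,
    cubicCoords_cubicFrame, cubicCoords_cubicFrame]
  ext i; fin_cases i <;> simp

/-- **Every menu normal of a frame `G` is `G (nC c)` for some sign vector.** -/
theorem eq_map_nC_of_menu (G : EuclideanSpace ℝ (Fin 3) ≃ₗᵢ[ℝ] EuclideanSpace ℝ (Fin 3)) {m : EuclideanSpace ℝ (Fin 3)} (hm : IsMenuNormal G m) :
    ∃ c : Fin 8, m = G (nC c) := by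
  obtain ⟨c, hc⟩ := exists_cubeInt_of_menu_normal G hm.1 hm.2
  refine ⟨c, ?_⟩
  have h : G.symm m = nC c := cubicCoords_injective (by rw [hc, cubicCoords_nC])
  rw [← h, LinearIsometryEquiv.apply_symm_apply]

/-- `⟪slot j, nC c⟫ = (slotInt j ⬝ cubeInt c)/√6`. -/
theorem inner_slotSite_nC (j : Fin 12) (c : Fin 8) : ⟪slotSite j, nC c⟫_ℝ = ((slotInt j ⬝ᵥ cubeInt c : ℤ) : ℝ) / Real.sqrt 6 := by
  rw [inner_eq_cubicCoords, cubicCoords_slotSite, cubicCoords_nC]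
  simp only [dotProduct, Fin.sum_univ_three, slotVec]
  have h6 : Real.sqrt 6 = Real.sqrt 2 * Real.sqrt 3 := by rw [← Real.sqrt_mul (by norm_num)]; norm_num
  rw [h6]; push_cast; field_simp; try ring

/-- Integer bridge tables: the own slots and the mirror images make up `twinIntC c`, and conversely. -/
theorem twinIntC_tables :
    (∀ c : Fin 8, ∀ j : Fin 12, slotInt j ⬝ᵥ cubeInt c ≤ 0 → ∃ k : Fin 12, ∀ i : Fin 3, twinIntC c k i = 3 * slotInt j i) ∧
    (∀ c : Fin 8, ∀ j : Fin 12, slotInt j ⬝ᵥ cubeInt c = -2 → ∃ k : Fin 12, ∀ i : Fin 3, twinIntC c k i = 3 * slotInt j i + 4 * cubeInt c i) ∧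
    (∀ c : Fin 8, ∀ k : Fin 12, (∃ j : Fin 12, slotInt j ⬝ᵥ cubeInt c ≤ 0 ∧ ∀ i : Fin 3, twinIntC c k i = 3 * slotInt j i) ∨
      (∃ j : Fin 12, slotInt j ⬝ᵥ cubeInt c = -2 ∧ ∀ i : Fin 3, twinIntC c k i = 3 * slotInt j i + 4 * cubeInt c i)) := by
  refine ⟨by decide, by decide, by decide⟩

/-- Real form of the own-slot bridge: a slot on the own side of `nC c` is a member of `twinSiteC c`. -/
theorem twinSiteC_own (c : Fin 8) {j : Fin 12} (hj : slotInt j ⬝ᵥ cubeInt c ≤ 0) : ∃ k : Fin 12, twinSiteC c k = slotSite j := by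
  obtain ⟨k, hk⟩ := twinIntC_tables.1 c j hj
  refine ⟨k, cubicCoords_injective ?_⟩
  rw [cubicCoords_twinSiteC, cubicCoords_slotSite]
  funext i
  simp only [slotVec, hk i]
  have hs : Real.sqrt 2 ≠ 0 := by positivity
  push_cast; field_simp; try ring

/-- Real form of the mirror bridge: the mirror image of a negative slot is a member of `twinSiteC c`. -/
theorem twinSiteC_mirror (c : Fin 8) {j : Fin 12} (hj : slotInt j ⬝ᵥ cubeInt c = -2) :
    ∃ k : Fin 12, twinSiteC c k = slotSite j - (2 * ⟪slotSite j, nC c⟫_ℝ) • nC c := by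
  obtain ⟨k, hk⟩ := twinIntC_tables.2.1 c j hj
  refine ⟨k, cubicCoords_injective ?_⟩
  rw [cubicCoords_sub, cubicCoords_smul, cubicCoords_twinSiteC, cubicCoords_slotSite, cubicCoords_nC, inner_slotSite_nC, hj]
  funext i
  simp only [Pi.sub_apply, Pi.smul_apply, smul_eq_mul, slotVec, hk i]
  have hs2 : Real.sqrt 2 ≠ 0 := by positivity
  have hs3 : Real.sqrt 3 ≠ 0 := by positivity
  have h6 : Real.sqrt 6 = Real.sqrt 2 * Real.sqrt 3 := by rw [← Real.sqrt_mul (by norm_num)]; norm_num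
  have hs3sq : Real.sqrt 3 ^ 2 = 3 := Real.sq_sqrt (by norm_num)
  rw [h6]; push_cast; field_simp; (try rw [hs3sq]); try ring

/-- Every member of `twinSiteC c` is an own slot or the mirror of a negative slot. -/
theorem twinSiteC_cases (c : Fin 8) (k : Fin 12) :
    (∃ j : Fin 12, slotInt j ⬝ᵥ cubeInt c ≤ 0 ∧ twinSiteC c k = slotSite j) ∨
      (∃ j : Fin 12, slotInt j ⬝ᵥ cubeInt c = -2 ∧ twinSiteC c k = slotSite j - (2 * ⟪slotSite j, nC c⟫_ℝ) • nC c) := by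
  rcases twinIntC_tables.2.2 c k with ⟨j, hj, hk⟩ | ⟨j, hj, hk⟩
  · left; refine ⟨j, hj, cubicCoords_injective ?_⟩
    rw [cubicCoords_twinSiteC, cubicCoords_slotSite]; funext i; simp only [slotVec, hk i]
    have hs : Real.sqrt 2 ≠ 0 := by positivity
    push_cast; field_simp; try ring
  · right; refine ⟨j, hj, cubicCoords_injective ?_⟩
    rw [cubicCoords_sub, cubicCoords_smul, cubicCoords_twinSiteC, cubicCoords_slotSite, cubicCoords_nC, inner_slotSite_nC, hj]
    funext i; simp only [Pi.sub_apply, Pi.smul_apply, smul_eq_mul, slotVec, hk i]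
    have hs2 : Real.sqrt 2 ≠ 0 := by positivity
    have hs3 : Real.sqrt 3 ≠ 0 := by positivity
    have h6 : Real.sqrt 6 = Real.sqrt 2 * Real.sqrt 3 := by rw [← Real.sqrt_mul (by norm_num)]; norm_num
    have hs3sq : Real.sqrt 3 ^ 2 = 3 := Real.sq_sqrt (by norm_num)
    rw [h6]; push_cast; field_simp; (try rw [hs3sq]); try ring

end TailResidue

end Summit.Ventures.Crystal3D.Theorems

end
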